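/-
Copyright (c) 2026 the pub-hodgecm-mathlib formalisation cell (harness21).  Prover seat hodgecm-mathlib-LH7-p06 (g0) (re-dealt to strike line L3 `stub_N6nsDyadic` by director
s1969 (a)), Track A «(D-RAM) FOUR-FRAME» squad, helper lane on h413 = stmt-HodgeConjecture-24833 (count-neutral).  β-BOARD row R8 ∕ (Z₃), FILE 5d′-a: the per-lattice labelled-odd
value of a core-hanging lattice under the CHARACTER label `ω(G)·θ` WITHOUT the near letter (LH7-p08 (g0)'s road 5a → 5b → 5b′ → 5d′ → 5d).  2026-09-04.
-/
import Summits.HodgeConjecture.HodgeConjecture.Theorems.F0P3cDyRamLabelledOddCoreHangingCharacterWindows   -- ★ p862316 (LH7-p08, FILE 5b′): the windows of `θ`; brings ★ 5b p862299 (`normSign_twoSlot_eq_reduced`, `theta_mul`) and ★ 4a p861966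
import Summits.HodgeConjecture.HodgeConjecture.Theorems.F0P3cDyRamLabelledOddCharacterSlotRead             -- ★ p862282 (LH7-p08, FILE 5a): HEAD′ `labelledOddCount_div_relIndex_eq_of_character`, `character_eq_one_of_label_invariant`
import Summits.HodgeConjecture.HodgeConjecture.Theorems.F0P3cDyRamLabelledOddCoreHangingClassSum           -- ★ (LH7-p08): `valueClassLabel_mul_norm_iff_of_mem_unitStabilizer` (the label is `N′`-invariant)
import HarnessLib

/-!
# Crux `H413`, line LH4 «(D-RAM) FOUR-FRAME» — (β) table, β-BOARD row R8 ∕ (Z₃), FILE 5d′-a: «THE θ-VALUE OF ONE CORE-HANGING LATTICE» — the per-lattice labelled-odd value under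
# the character label, near letter dropped: `m^Λ_i(M)∕[𝒰 : N′] = w(M)∕2 · ω(D_i) · ω(G) · (ι, ι, J)_i`

Cell `hodgecm-mathlib` (D-0151), FLOOR 0, crux item H413 = `stmt-HodgeConjecture-24833`, route `HCCMUnconditional`; squad F0∕P3c∕LH7 (hand on the LH4 β-board).  THEOREMS ONLY
(no `def`, no instance, no notation, no `sorry`, default heartbeats); ★-only imports; lane `--supports stmt-HodgeConjecture-24833 --as helper` (count-neutral); pays NO row, states NO law.

THE MATHEMATICS (LH7-p08 (g0)'s MATH NOTE 2026-09-04 21:33Z and the 5d′ letter 21:55Z).  `M = latt(1 0 0; x ϖ^ρ 0; xζ+f·xζ ϖ^ρζ ϖ^{2ρ})` a core-hanging member (`x, ζ` units, `f` a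
σ-fixed unit, `|1+f| = 1`, `ρ ≥ 1`), `T`-stable, normalised-stable, on the clean shell; fixed approximants `g_α, g_β`, `G := f·g_α + g_β ≠ 0`, with the DOMINANCE letter
`|ϖ|^{2ρ}|g_α| ≤ |ϖ|^{2d−1}|G|` and the unit letter `|g_β − g_α| ≤ |G|` — but NOT the near letter `|ϖ|^ρ|g_β − g_α| ≤ |ϖ|^{2d−1}|G|` of ★ 4a.
* ★ FILE 2a + ★ κH (A1) read the (β) label of the class `D·u` (`u ∈ S_F(M)`) as `ω(u₀·f·g_α + u₁·g_β) = 1`; ★ 5b's bridge turns it into `ω(G)·θ(u) = 1` with the CHARACTER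
  `θ(u) = ω(G)·ω((1+f)g_α·u₂ + (g_β − g_α)·u₁)` (multiplicative on `S_F` by ★ 5b `theta_mul`, `±1`-valued, trivial on `N′` because the label is `N′`-invariant, ★ 5a §1).
* ★ 5a HEAD′ then gives `m^Λ_i(M)∕[𝒰 : N′] = ω(G)·ω(D_i)∕2 · [ω_i·θ ≡ 1 on S_F] · w(M)`, and ★ 5b′ evaluates the three brackets: slot 2 is `J = [|ϖ|^ρ|g_β − g_α| ≤ |ϖ|^{2d−1}|G|]`
  (near ⇒ `≡ 1`; not near ⇒ FAR `|ϖ|^{2d−2}|G| ≤ |ϖ|^ρ|g_β − g_α|` by discreteness of `|·|` (§0) ⇒ a witness `ω₂θ(u_t) = −1`); slots 0, 1 are `ι = [2d−1 ≤ ρ]` (alive ⇒ `≡ 1`;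
  dead `ρ ≤ 2d−2` ⇒ witnesses, under the two unit letters `|G + (g_β−g_α)| = |G|`, `|G − f(g_β−g_α)| = |G|`, asked only in the dead window).  Under `|g_β − g_α| ≤ |G|` the alive
  window implies the near regime, so the bracket vector is `[(i = 2 ∧ near) ∨ 2d−1 ≤ ρ]` — ★ 4a §3's `[i = 2 ∨ 2d−1 ≤ ρ]` VERBATIM when the near letter holds.
* §0 `far_of_not_near` (discreteness); §1 HEAD `labelledOddCount_div_relIndex_coreHanging_eq_of_theta`.  FILE 5d′-b (LH7-p07 (g0)) sums it over one core-hanging orbit.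
HONEST LABEL.  Count-neutral (`--supports`); the orbit version 5d′, the shallow H row `hZ₃` (5c, 5d), `hRest`, (T3), (β-BAL), (β), T₊ stay OPEN; `HC_CM` is proved only modulo the 7
printed citations (2 remaining named inputs: hLiu418 = `stmt-HodgeConjecture-24832`, h413 = `stmt-HodgeConjecture-24833`) until rung 0 closes.

## References
* [Kottwitz1986BaseChangeUnits] R. E. Kottwitz, *Base change for unit elements of Hecke algebras*, Compositio Math. 60 (1986), §1 pp. 240–241 (signed lattice counts modulo the torus).
* [LanglandsShelstad1987] R. P. Langlands, D. Shelstad, *On the definition of transfer factors*, Math. Ann. 278 (1987), §3.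
* [Rogawski1990] J. D. Rogawski, *Automorphic Representations of Unitary Groups in Three Variables*, Ann. of Math. Stud. 123 (1990), §4.9 Prop. 4.9.1 (a)(b) p. 55, §4.10 p. 58.
* [Serre1979] J.-P. Serre, *Local Fields*, GTM 67 (1979), Ch. II §1 (discrete valuations), Ch. V §3 Cor. 3, Ch. XV §2 (the conductor of the quadratic character).
-/

set_option autoImplicit false

noncomputable section

namespace Summit.HodgeConjecture.HodgeConjecture.Cruxes.H413.F0P3cDyRamLabelledOddCoreHangingThetaRead

open Matrix WithZero
open Literature.NumberTheory.Automorphic Literature.NumberTheory.Automorphic.HermitianLattice Literature.NumberTheory.Automorphic.UnitaryGroup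
open Literature.NumberTheory.Automorphic.UnitaryLatticeTree Literature.NumberTheory.Automorphic.UnitaryThreeFourFrame
open Literature.NumberTheory.LocalFields Literature.NumberTheory.LocalFields.WildQuadraticDatum
open Summit.HodgeConjecture.HodgeConjecture.Cruxes.H413.F0P3cDyRamFourFramePieces
open Summit.HodgeConjecture.HodgeConjecture.Cruxes.H413.F0P3cDyRamFourFrameCensusDefs
open Summit.HodgeConjecture.HodgeConjecture.Cruxes.H413.F0P3cDyRamDiagonalTorusDefs
open Summit.HodgeConjecture.HodgeConjecture.Cruxes.H413.F0P3cDyRamLabelledOddCountDefs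
open Summit.HodgeConjecture.HodgeConjecture.Cruxes.H413.F0P3cDyRamTwoSlotLabelReadCoreHanging (valueClassLabel_latt_coreHanging_iff_normSign_linear)
open Summit.HodgeConjecture.HodgeConjecture.Cruxes.H413.F0P3cDyRamLabelledOddOneSlotRead (map_unitNormMap_unitStabilizer_le)
open Summit.HodgeConjecture.HodgeConjecture.Cruxes.H413.F0P3cDyRamLabelledOddCharacterSlotRead (labelledOddCount_div_relIndex_eq_of_character character_eq_one_of_label_invariant)
open Summit.HodgeConjecture.HodgeConjecture.Cruxes.H413.F0P3cDyRamLabelledOddCoreHangingCharacterRead (normSign_twoSlot_eq_reduced theta_mul)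
open Summit.HodgeConjecture.HodgeConjecture.Cruxes.H413.F0P3cDyRamLabelledOddCoreHangingCharacterWindows
open Summit.HodgeConjecture.HodgeConjecture.Cruxes.H413.F0P3cDyRamLabelledOddCoreHangingClassSum (valueClassLabel_mul_norm_iff_of_mem_unitStabilizer)
open Summit.HodgeConjecture.HodgeConjecture.Cruxes.H413.F0P3cDyRamStableSumSignClasses (normSign_eq_one_or)
open Summit.HodgeConjecture.HodgeConjecture.Cruxes.H413.F0P3cDyRamDiagonalKappaCoreHangingClass
open Summit.HodgeConjecture.HodgeConjecture.Cruxes.H413.F0P3cDyRamDiagonalCoreHangingPolarisationExplicit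
open Summit.HodgeConjecture.HodgeConjecture.Cruxes.H413.F0P3cDyRamDiagonalGluedFixedStabiliser (mem_fixedUnitStabilizer_latt_glued_iff)
open Summit.HodgeConjecture.HodgeConjecture.Cruxes.H413.F0P3cDyRamDiagonalOrbitFibreTransport (fibre_isCoset_zero)
open Summit.HodgeConjecture.HodgeConjecture.Cruxes.H413.F0P3cDyRamDiagonalOrbitFibreCountHeads (finite_unitTorus_orbit_of_mem_normalisedStableLattices)
open Summit.HodgeConjecture.HodgeConjecture.Cruxes.H413.F0P3cDyRamDiagonalCoreHangingCount (isNormalisedLattice_latt_coreHanging)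
open Summit.HodgeConjecture.HodgeConjecture.Cruxes.H413.F0P3cDyRamStableCountTypeZero (v_diag_eq_one diag_regular)
open Summit.HodgeConjecture.HodgeConjecture.Cruxes.H413.F0P3cDyRamDiagonalKappaSplitCountEval (normSign_mul_self)
open scoped Valued WithZero Matrix MatrixGroups

variable {K : Type} [Field K] [Valued K ℤᵐ⁰]

/-! ## §0  Discreteness: not near ⇒ far -/

/-- **NOT NEAR ⇒ FAR.**  For `G ≠ 0`: if `|ϖ|^ρ·|b| ≤ |ϖ|^{2d−1}·|G|` FAILS then `|ϖ|^{2d−2}·|G| ≤ |ϖ|^ρ·|b|` — the value group is `|ϖ|^ℤ`, so a strict inequality between two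
non-zero values improves by one power of `|ϖ|`. [cite: Serre1979, Ch. II §1] -/
theorem far_of_not_near {ϖ : K} (hϖ : Valued.v ϖ = exp (-1 : ℤ)) {ρ d : ℕ} {G b : K} (hG0 : G ≠ 0)
    (h : ¬ Valued.v ϖ ^ ρ * Valued.v b ≤ Valued.v ϖ ^ (2 * d - 1) * Valued.v G) :
    Valued.v ϖ ^ (2 * d - 2) * Valued.v G ≤ Valued.v ϖ ^ ρ * Valued.v b := by
  have hlt := not_le.1 h
  have hb0 : Valued.v b ≠ 0 := by
    intro h0
    rw [h0, mul_zero] at hlt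
    exact absurd hlt (not_lt.2 zero_le)
  have hG0' : Valued.v G ≠ 0 := (Valuation.ne_zero_iff _).2 hG0
  rw [← WithZero.exp_log hb0, ← WithZero.exp_log hG0', v_varpi_pow hϖ, v_varpi_pow hϖ, ← WithZero.exp_add, ← WithZero.exp_add, WithZero.exp_lt_exp] at hlt
  rw [← WithZero.exp_log hb0, ← WithZero.exp_log hG0', v_varpi_pow hϖ, v_varpi_pow hϖ, ← WithZero.exp_add, ← WithZero.exp_add, WithZero.exp_le_exp]
  omega

/-! ## §1  HEAD — the labelled-odd value of a core-hanging lattice under the character label `ω(G)·θ` -/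

/-- **THE θ-VALUE OF ONE CORE-HANGING LATTICE.**  Ramified datum (`|2| < 1`, complete, finite residue field), `ρ ≥ 1`; a member `M = latt(1 0 0; x ϖ^ρ 0; xζ+f·xζ ϖ^ρζ ϖ^{2ρ})`
of the core-hanging stratum (`x, ζ` units, `f` a fixed unit with `|1+f| = 1`) which is `T`-stable and normalised-stable, on the clean shell, with fixed approximants `g_α, g_β`
(`|ϖ^{−m*}·π₀^{−ρ}·((α−1) − g_α t₊)| ≤ 1`, same for `β`), `G := f·g_α + g_β ≠ 0`, the dominance letter `|ϖ|^{2ρ}|g_α| ≤ |ϖ|^{2d−1}|G|`, the unit letter `|g_β − g_α| ≤ |G|`, and —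
asked only in the dead window `ρ ≤ 2d − 2` — the two unit letters `|G + (g_β − g_α)| = |G|`, `|G − f(g_β − g_α)| = |G|`.  Then for every slot `i`
`labelledOddCount σ ϖ 0 i Λ M ∕ [𝒰 : N(S̃(M))] = stabiliserWeight σ M ∕ 2 · (ω(f), 1, ω(−(1+f)))_i · ω(G) · [(i = 2 ∧ |ϖ|^ρ|g_β−g_α| ≤ |ϖ|^{2d−1}|G|) ∨ 2d−1 ≤ ρ]`,
`Λ = valueClassLabel σ ϖ (α−1) (β−1) m* d` — ★ 5a HEAD′ for the character `θ = ω(G)·ω(L♭)` of ★ 5b, brackets by ★ 5b′; equals ★ 4a §3 VERBATIM when the near letter holds, and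
VANISHES in the far dead case (`ρ ≤ 2d−2`, not near).
[cite: Kottwitz1986BaseChangeUnits, §1 pp. 240–241] [cite: LanglandsShelstad1987, §3] [cite: Rogawski1990, §4.9 Prop. 4.9.1 (a)(b) p. 55, §4.10 p. 58] [cite: Serre1979, Ch. XV §2] -/
theorem labelledOddCount_div_relIndex_coreHanging_eq_of_theta [CompleteSpace K] [Finite 𝓀[K]] {σ : K →+* K} {ϖ : K} {d t : ℕ}
    (hD : IsRamifiedQuadraticDatum σ ϖ d t) (h2 : Valued.v (2 : K) < 1)
    {ρ : ℕ} (hρ : 1 ≤ ρ) {x ζ f : K} (hx : Valued.v x = 1) (hζ : Valued.v ζ = 1) (hσf : σ f = f) (hf : Valued.v f = 1) (h1f : Valued.v (1 + f) = 1)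
    (V : GL (Fin 3) K) (hV : (V : Matrix (Fin 3) (Fin 3) K) = !![1, 0, 0; x, ϖ ^ ρ, 0; x * ζ + f * (x * ζ), ϖ ^ ρ * ζ, ϖ ^ (2 * ρ)])
    {α β : K} {N₀ n₁ n₂ n₃ : ℕ} (hE : IsElementDatum σ ϖ N₀ α β n₁ n₂ n₃) {mc : ℕ} (hℓN : d % 2 + 1 ≤ N₀) (hmN : d % 2 + 2 * d - 1 ≤ N₀)
    (hℓmc : 2 * (d % 2) + 1 ≤ mc) (hmmc : d % 2 + 2 * d - 1 + d % 2 ≤ mc)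
    {T : GL (Fin 3) K} (hT : (T : Matrix (Fin 3) (Fin 3) K) = Matrix.diagonal ![α, β, 1]) (hM0 : latt (V : Matrix (Fin 3) (Fin 3) K) ∈ normalisedStableLattices T)
    (hlev : LatticeInLevel ϖ (d % 2) (Matrix.diagonal ![α - 1, β - 1, 0]) (latt (V : Matrix (Fin 3) (Fin 3) K)))
    (hnlev : ¬ LatticeInLevel ϖ (d % 2 + 1) (Matrix.diagonal ![α - 1, β - 1, 0]) (latt (V : Matrix (Fin 3) (Fin 3) K)))
    (hsq : LatticeInLevel ϖ mc (Matrix.diagonal ![(α - 1) * (α - 1), (β - 1) * (β - 1), 0]) (latt (V : Matrix (Fin 3) (Fin 3) K)))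
    {gα gβ : K} (hσgα : σ gα = gα) (hσgβ : σ gβ = gβ) (hG0 : f * gα + gβ ≠ 0)
    (hdom : Valued.v ϖ ^ (2 * ρ) * Valued.v gα ≤ Valued.v ϖ ^ (2 * d - 1) * Valued.v (f * gα + gβ))
    (hb : Valued.v (gβ - gα) ≤ Valued.v (f * gα + gβ))
    (hGb : ρ ≤ 2 * d - 2 → Valued.v (f * gα + gβ + (gβ - gα)) = Valued.v (f * gα + gβ))
    (hGfb : ρ ≤ 2 * d - 2 → Valued.v (f * gα + gβ - f * (gβ - gα)) = Valued.v (f * gα + gβ))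
    (hgα : Valued.v ((ϖ ^ (d % 2 + 2 * d - 1))⁻¹ * (((ϖ * σ ϖ) ^ ρ)⁻¹ * ((α - 1) - gα * ((ϖ - σ ϖ) * ((ϖ * σ ϖ) ^ ((d - d % 2) / 2))⁻¹)))) ≤ 1)
    (hgβ : Valued.v ((ϖ ^ (d % 2 + 2 * d - 1))⁻¹ * (((ϖ * σ ϖ) ^ ρ)⁻¹ * ((β - 1) - gβ * ((ϖ - σ ϖ) * ((ϖ * σ ϖ) ^ ((d - d % 2) / 2))⁻¹)))) ≤ 1)
    (i : Fin 3) :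
    (labelledOddCount σ ϖ 0 i (valueClassLabel σ ϖ (α - 1) (β - 1) (d % 2 + 2 * d - 1) d) (latt (V : Matrix (Fin 3) (Fin 3) K)) : ℚ) /
        ((((unitStabilizer (latt (V : Matrix (Fin 3) (Fin 3) K))).map (unitNormMap σ 3)).relIndex (fixedUnitTorus σ 3) : ℕ) : ℚ) =
      stabiliserWeight σ (latt (V : Matrix (Fin 3) (Fin 3) K)) / 2 *
        ((((![normSign σ f, 1, normSign σ (-(1 + f))] : Fin 3 → ℤ) i * normSign σ (f * gα + gβ) *
          (if (i = 2 ∧ Valued.v ϖ ^ ρ * Valued.v (gβ - gα) ≤ Valued.v ϖ ^ (2 * d - 1) * Valued.v (f * gα + gβ)) ∨ 2 * d - 1 ≤ ρ then 1 else 0) : ℤ)) : ℚ) := by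
  classical
  have hTr := trace_bound_of_isRamifiedQuadraticDatum hD h2
  obtain ⟨hσ, hvσ, hϖ, hfix, hdd, hd1, -⟩ := id hD
  haveI := isAdicComplete_valuedInteger_of_completeSpace hϖ
  have hϖ0 : ϖ ≠ 0 := fun h => by rw [h, map_zero] at hϖ; exact (exp_ne_zero hϖ.symm).elim
  have hϖ1 : Valued.v ϖ < 1 := by rw [hϖ, ← exp_zero, exp_lt_exp]; norm_num
  have hζ0 : ζ ≠ 0 := fun h => by rw [h, map_zero] at hζ; exact zero_ne_one hζ
  have hx0 : x ≠ 0 := fun h => by rw [h, map_zero] at hx; exact zero_ne_one hx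
  have hf0 : f ≠ 0 := fun h => by rw [h, map_zero] at hf; exact zero_ne_one hf
  have h1f0 : 1 + f ≠ 0 := fun h => by rw [h, map_zero] at h1f; exact zero_ne_one h1f
  -- the unit letters of the member
  have hy''1 : Valued.v (f * (x * ζ)) = 1 := by rw [map_mul, map_mul, hf, hx, hζ, one_mul, one_mul]
  have hy1 : Valued.v (x * ζ + f * (x * ζ)) = 1 := by
    rw [show x * ζ + f * (x * ζ) = x * ζ * (1 + f) by ring, map_mul, map_mul, hx, hζ, h1f, one_mul, one_mul]
  -- ★ κH (A1): the explicit polarisation with lineariser `f′ = f·Nζ`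
  have hσf' : σ (f * (ζ * σ ζ)) = f * (ζ * σ ζ) := by rw [map_mul, map_mul, hσf, hσ, mul_comm (σ ζ) ζ]
  have hR : Valued.v (ζ * σ (f * (x * ζ)) - σ x * (f * (ζ * σ ζ))) ≤ Valued.v ϖ ^ ρ := by
    rw [show ζ * σ (f * (x * ζ)) - σ x * (f * (ζ * σ ζ)) = 0 by rw [map_mul, map_mul, hσf]; ring, map_zero]; exact zero_le
  obtain ⟨D, ⟨hD1, hD2, hD0⟩, hDσ, hDV⟩ := exists_explicit_polarisation_latt_hnf_coreHanging hσ hvσ hϖ0 hϖ1 hTr ρ hρ hx hζ hy''1 hy1 V hV hσf' hR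
  obtain ⟨hω1, hω2, hω0⟩ := normSign_polarisation_coreHanging σ hϖ0 ρ hx hζ hσf hf h1f hD1 hD2 hD0
  -- `D₀ = D₁·N(x)·f`
  have hN0 : ζ * σ ζ ≠ 0 := mul_ne_zero hζ0 ((map_ne_zero σ).2 hζ0)
  have hσϖ0 : σ ϖ ≠ 0 := (map_ne_zero σ).2 hϖ0
  have hπ0 : ((ϖ * σ ϖ) ^ ρ : K) ≠ 0 := pow_ne_zero _ (mul_ne_zero hϖ0 hσϖ0)
  have hσζ0 : σ ζ ≠ 0 := (map_ne_zero σ).2 hζ0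
  have hσx0 : σ x ≠ 0 := (map_ne_zero σ).2 hx0
  have hNf : ζ * σ ζ + f * (ζ * σ ζ) ≠ 0 := by
    rw [show ζ * σ ζ + f * (ζ * σ ζ) = ζ * σ ζ * (1 + f) by ring]; exact mul_ne_zero hN0 h1f0
  have hD0' : D 0 = D 1 * (x * σ x) * f := by
    have hy : x * ζ + f * (x * ζ) = x * ζ * (1 + f) := by ring
    rw [hD0, hD1, hy, map_mul, map_mul, map_add, map_one, hσf]
    field_simp
    ring
  -- normalised; the type-0 fibre is one `S_F`-coset; the orbit is finite; the NI2 letters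
  have hnorm : IsNormalisedLattice (latt (V : Matrix (Fin 3) (Fin 3) K)) := by rw [hV]; exact isNormalisedLattice_latt_coreHanging hϖ1.le ρ hx hζ hy1
  have hcoset : ∀ D' : Fin 3 → K, (∀ j, σ (D' j) = D' j ∧ D' j ≠ 0) →
      (IsVertexLattice σ ϖ (Matrix.diagonal D') 0 (latt (V : Matrix (Fin 3) (Fin 3) K)) ↔
        ∃ u ∈ fixedUnitStabilizer σ (latt (V : Matrix (Fin 3) (Fin 3) K)), ∀ j, D' j = D j * ((u j : Kˣ) : K)) :=
    fun D' hD' => fibre_isCoset_zero hvσ ϖ V rfl hnorm D hDσ hDV D' hD'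
  have hfin := finite_unitTorus_orbit_of_mem_normalisedStableLattices hϖ (v_diag_eq_one hvσ hE) (diag_regular hE) T hT hM0
  obtain ⟨c, hσc, hcv, hcn, hdich⟩ := exists_nonnorm_dichotomy_of_isRamifiedQuadraticDatum σ ϖ d t hD
  have hTM : mapGL T (latt (V : Matrix (Fin 3) (Fin 3) K)) = latt (V : Matrix (Fin 3) (Fin 3) K) := hM0.2.1
  -- the character `θ = ω(G)·ω(L♭)` and the sign `ε = ω(G)`
  obtain ⟨θ, hθ⟩ : ∃ θ : (Fin 3 → Kˣ) → ℤ, ∀ u, θ u =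
      normSign σ (f * gα + gβ) * normSign σ ((1 + f) * gα * ((u 2 : Kˣ) : K) + (gβ - gα) * ((u 1 : Kˣ) : K)) := ⟨_, fun _ => rfl⟩
  have hsqG : normSign σ (f * gα + gβ) * normSign σ (f * gα + gβ) = 1 := normSign_mul_self σ (f * gα + gβ)
  have hε : normSign σ (f * gα + gβ) = 1 ∨ normSign σ (f * gα + gβ) = -1 := normSign_eq_one_or σ _
  -- the label on `S_F`: `Λ(D·u) ↔ ε·θ(u) = 1` (FILE 2a's two-slot read, then ★ 5b's bridge)
  have hΛ : ∀ u ∈ fixedUnitStabilizer σ (latt (V : Matrix (Fin 3) (Fin 3) K)),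
      valueClassLabel σ ϖ (α - 1) (β - 1) (d % 2 + 2 * d - 1) d (latt (V : Matrix (Fin 3) (Fin 3) K)) (fun j => D j * ((u j : Kˣ) : K)) ↔
        normSign σ (f * gα + gβ) * θ u = 1 := by
    intro u hu
    have hufix : ∀ j, σ ((u j : Kˣ) : K) = u j := fun j => ((mem_fixedUnitTorus_iff σ u).1 hu.2).2 j
    have huv : ∀ j, Valued.v ((u j : Kˣ) : K) = 1 := fun j => ((mem_fixedUnitTorus_iff σ u).1 hu.2).1 j
    have hDu : ∀ j, σ (D j * ((u j : Kˣ) : K)) = D j * ((u j : Kˣ) : K) ∧ D j * ((u j : Kˣ) : K) ≠ 0 := fun j =>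
      ⟨by rw [map_mul, (hDσ j).1, hufix j], mul_ne_zero (hDσ j).2 (u j).ne_zero⟩
    have hMu : IsVertexLattice σ ϖ (Matrix.diagonal fun j => D j * ((u j : Kˣ) : K)) 0 (latt (V : Matrix (Fin 3) (Fin 3) K)) :=
      (hcoset _ hDu).2 ⟨u, hu, fun _ => rfl⟩
    -- the weights `D₀u₀ = π₀^{−ρ}·(N(x) f u₀)` and `D₁u₁N(x) = π₀^{−ρ}·(u₁ N(x))` are `π₀^{−ρ}` times units
    have hwt0 : Valued.v (x * σ x * f * ((u 0 : Kˣ) : K)) ≤ 1 := by rw [map_mul, map_mul, map_mul, hx, hvσ, hx, hf, huv 0]; norm_num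
    have hwt1 : Valued.v (((u 1 : Kˣ) : K) * (x * σ x)) ≤ 1 := by rw [map_mul, map_mul, huv 1, hx, hvσ, hx]; norm_num
    have hgαu : Valued.v ((ϖ ^ (d % 2 + 2 * d - 1))⁻¹ *
        (D 0 * ((u 0 : Kˣ) : K) * ((α - 1) - gα * ((ϖ - σ ϖ) * ((ϖ * σ ϖ) ^ ((d - d % 2) / 2))⁻¹)))) ≤ 1 := by
      have e : (ϖ ^ (d % 2 + 2 * d - 1))⁻¹ * (D 0 * ((u 0 : Kˣ) : K) * ((α - 1) - gα * ((ϖ - σ ϖ) * ((ϖ * σ ϖ) ^ ((d - d % 2) / 2))⁻¹))) =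
          (x * σ x * f * ((u 0 : Kˣ) : K)) * ((ϖ ^ (d % 2 + 2 * d - 1))⁻¹ * (((ϖ * σ ϖ) ^ ρ)⁻¹ * ((α - 1) - gα * ((ϖ - σ ϖ) * ((ϖ * σ ϖ) ^ ((d - d % 2) / 2))⁻¹)))) := by
        rw [hD0', hD1]; ring
      rw [e, map_mul]; exact mul_le_one' hwt0 hgα
    have hgβu : Valued.v ((ϖ ^ (d % 2 + 2 * d - 1))⁻¹ *
        (D 1 * ((u 1 : Kˣ) : K) * (x * σ x) * ((β - 1) - gβ * ((ϖ - σ ϖ) * ((ϖ * σ ϖ) ^ ((d - d % 2) / 2))⁻¹)))) ≤ 1 := by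
      have e : (ϖ ^ (d % 2 + 2 * d - 1))⁻¹ * (D 1 * ((u 1 : Kˣ) : K) * (x * σ x) * ((β - 1) - gβ * ((ϖ - σ ϖ) * ((ϖ * σ ϖ) ^ ((d - d % 2) / 2))⁻¹))) =
          (((u 1 : Kˣ) : K) * (x * σ x)) * ((ϖ ^ (d % 2 + 2 * d - 1))⁻¹ * (((ϖ * σ ϖ) ^ ρ)⁻¹ * ((β - 1) - gβ * ((ϖ - σ ϖ) * ((ϖ * σ ϖ) ^ ((d - d % 2) / 2))⁻¹)))) := by
        rw [hD1]; ring
      rw [e, map_mul]; exact mul_le_one' hwt1 hgβ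
    have hread := valueClassLabel_latt_coreHanging_iff_normSign_linear hD hρ hx hζ hy1 V hV (D := fun j => D j * ((u j : Kˣ) : K))
      (fun j => (hDu j).1) (fun j => (hDu j).2) hMu hE hℓN hmN hℓmc hmmc hlev hnlev hsq hT hTM hσgα hσgβ hgαu hgβu
    rw [hread]
    -- `D₀u₀·g_α + D₁u₁·N(x)·g_β = (D₁·N(x)) · (u₀ f g_α + u₁ g_β)`, and `ω(D₁·N(x)) = 1`
    have hfac : D 0 * ((u 0 : Kˣ) : K) * gα + D 1 * ((u 1 : Kˣ) : K) * (x * σ x) * gβ =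
        (D 1 * (x * σ x)) * (((u 0 : Kˣ) : K) * f * gα + ((u 1 : Kˣ) : K) * gβ) := by rw [hD0']; ring
    have hσD1x : σ (D 1 * (x * σ x)) = D 1 * (x * σ x) := by rw [map_mul, (hDσ 1).1, map_mul, hσ, mul_comm (σ x) x]
    have hD1x0 : D 1 * (x * σ x) ≠ 0 := mul_ne_zero (hDσ 1).2 (mul_ne_zero hx0 ((map_ne_zero σ).2 hx0))
    have hωD1x : normSign σ (D 1 * (x * σ x)) = 1 := by
      rw [normSign_mul_of_fixed hD (hDσ 1).1 (by rw [map_mul, hσ, mul_comm]) (hDσ 1).2 (mul_ne_zero hx0 ((map_ne_zero σ).2 hx0)), hω1, one_mul]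
      exact normSign_of_isNorm σ ⟨x, rfl⟩
    have hS0 : σ (((u 0 : Kˣ) : K) * f * gα + ((u 1 : Kˣ) : K) * gβ) = ((u 0 : Kˣ) : K) * f * gα + ((u 1 : Kˣ) : K) * gβ := by
      rw [map_add, map_mul, map_mul, map_mul, hufix 0, hσf, hσgα, hufix 1, hσgβ]
    -- ★ 5b's bridge: `ω(u₀ f g_α + u₁ g_β) = ω(L♭(u))`
    obtain ⟨hZ0, hZ⟩ := normSign_twoSlot_eq_reduced hD hρ hx hζ hσf hf V hV hσgα hσgβ hG0 hdom hb hu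
    rw [hfac, normSign_mul_of_fixed hD hσD1x hS0 hD1x0 hZ0, hωD1x, one_mul, hZ, hθ, ← mul_assoc, hsqG, one_mul]
  -- `θ` is multiplicative, `±1`-valued, and trivial on `N′` (the label is `N′`-invariant)
  have hθmul : ∀ u ∈ fixedUnitStabilizer σ (latt (V : Matrix (Fin 3) (Fin 3) K)), ∀ u' ∈ fixedUnitStabilizer σ (latt (V : Matrix (Fin 3) (Fin 3) K)),
      θ (u * u') = θ u * θ u' := fun u hu u' hu' => by
    rw [hθ, hθ, hθ]; exact theta_mul hD hρ hx hζ hσf hf V hV hσgα hσgβ hG0 hdom hb hu hu'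
  have hθ1 : ∀ u ∈ fixedUnitStabilizer σ (latt (V : Matrix (Fin 3) (Fin 3) K)), θ u = 1 ∨ θ u = -1 := fun u _ => by
    rw [hθ]
    rcases normSign_eq_one_or σ (f * gα + gβ) with hG1 | hG1 <;>
      rcases normSign_eq_one_or σ ((1 + f) * gα * ((u 2 : Kˣ) : K) + (gβ - gα) * ((u 1 : Kˣ) : K)) with hL1 | hL1 <;>
        rw [hG1, hL1] <;> norm_num
  have hNS := map_unitNormMap_unitStabilizer_le σ hσ ϖ 0 hDσ hDV hcoset
  have hΛN : ∀ n ∈ (unitStabilizer (latt (V : Matrix (Fin 3) (Fin 3) K))).map (unitNormMap σ 3),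
      valueClassLabel σ ϖ (α - 1) (β - 1) (d % 2 + 2 * d - 1) d (latt (V : Matrix (Fin 3) (Fin 3) K)) (fun j => D j * ((n j : Kˣ) : K)) ↔
        valueClassLabel σ ϖ (α - 1) (β - 1) (d % 2 + 2 * d - 1) d (latt (V : Matrix (Fin 3) (Fin 3) K)) D := fun n hn =>
    valueClassLabel_mul_norm_iff_of_mem_unitStabilizer σ ϖ (α - 1) (β - 1) (d % 2 + 2 * d - 1) d hn D
  have hθN := character_eq_one_of_label_invariant hNS (valueClassLabel σ ϖ (α - 1) (β - 1) (d % 2 + 2 * d - 1) d) hε θ hθmul hθ1 hΛ hΛN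
  -- ★ 5a HEAD′
  have hhead := labelledOddCount_div_relIndex_eq_of_character hσ hvσ hσc hcv hcn hdich hfin hDσ hDV hcoset
    (valueClassLabel σ ϖ (α - 1) (β - 1) (d % 2 + 2 * d - 1) d) i hε θ hθmul hθ1 hθN hΛ
  rw [hhead]
  -- the ω-table of `D`
  have hωD : ∀ j : Fin 3, normSign σ (D j) = (![normSign σ f, 1, normSign σ (-(1 + f))] : Fin 3 → ℤ) j := fun j => by
    fin_cases j
    · exact hω0
    · exact hω1
    · exact hω2
  -- the brackets `[ω_i·θ ≡ 1 on S_F]`, slot by slot (★ 5b′)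
  have hi : i = 0 ∨ i = 1 ∨ i = 2 := by fin_cases i <;> simp
  have hind : (if ∀ u ∈ fixedUnitStabilizer σ (latt (V : Matrix (Fin 3) (Fin 3) K)), normSign σ ((u i : Kˣ) : K) * θ u = 1 then (1 : ℤ) else 0) =
      (if (i = 2 ∧ Valued.v ϖ ^ ρ * Valued.v (gβ - gα) ≤ Valued.v ϖ ^ (2 * d - 1) * Valued.v (f * gα + gβ)) ∨ 2 * d - 1 ≤ ρ then 1 else 0) := by
    by_cases hal : 2 * d - 1 ≤ ρ
    · -- the alive window (near is automatic under `|g_β − g_α| ≤ |G|`)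
      have hnear : Valued.v ϖ ^ ρ * Valued.v (gβ - gα) ≤ Valued.v ϖ ^ (2 * d - 1) * Valued.v (f * gα + gβ) :=
        mul_le_mul' (pow_le_pow_right_of_le_one' hϖ1.le hal) hb
      rw [if_pos (Or.inr hal)]
      refine if_pos fun u hu => ?_
      rw [hθ]
      rcases hi with rfl | rfl | rfl
      · exact forall_normSign_mul_theta_eq_one_of_le hD hal hx hζ hσf hf V hV hσgα hσgβ hG0 hb 0 (Or.inl rfl) u hu
      · exact forall_normSign_mul_theta_eq_one_of_le hD hal hx hζ hσf hf V hV hσgα hσgβ hG0 hb 1 (Or.inr rfl) u hu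
      · exact forall_normSign_two_mul_theta_eq_one hD hx hζ hσf hf V hV hσgα hσgβ hG0 hnear u hu
    · have hdead : ρ ≤ 2 * d - 2 := by omega
      rcases hi with rfl | rfl | rfl
      · -- slot 0, dead window: a witness
        have hR : (if ((0 : Fin 3) = 2 ∧ Valued.v ϖ ^ ρ * Valued.v (gβ - gα) ≤ Valued.v ϖ ^ (2 * d - 1) * Valued.v (f * gα + gβ)) ∨ 2 * d - 1 ≤ ρ then (1 : ℤ) else 0) = 0 :=
          if_neg fun h => h.elim (fun h' => absurd h'.1 (by decide)) hal
        rw [hR, ite_eq_right_iff]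
        intro hall
        exfalso
        obtain ⟨u, hu, hne⟩ := exists_normSign_zero_mul_theta_eq_neg_one hD h2 hρ hdead hx hζ hσf hf V hV hσgα hσgβ hG0 hb (hGfb hdead)
        have h1 := hall u hu
        rw [hθ] at h1
        rw [h1] at hne
        norm_num at hne
      · -- slot 1, dead window: a witness
        have hR : (if ((1 : Fin 3) = 2 ∧ Valued.v ϖ ^ ρ * Valued.v (gβ - gα) ≤ Valued.v ϖ ^ (2 * d - 1) * Valued.v (f * gα + gβ)) ∨ 2 * d - 1 ≤ ρ then (1 : ℤ) else 0) = 0 :=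
          if_neg fun h => h.elim (fun h' => absurd h'.1 (by decide)) hal
        rw [hR, ite_eq_right_iff]
        intro hall
        exfalso
        obtain ⟨u, hu, hne⟩ := exists_normSign_one_mul_theta_eq_neg_one hD h2 hρ hdead hx hζ hσf hf V hV hσgα hσgβ hG0 hb (hGb hdead)
        have h1 := hall u hu
        rw [hθ] at h1
        rw [h1] at hne
        norm_num at hne
      · -- slot 2: near ∕ far
        by_cases hnear : Valued.v ϖ ^ ρ * Valued.v (gβ - gα) ≤ Valued.v ϖ ^ (2 * d - 1) * Valued.v (f * gα + gβ)
        · rw [if_pos (Or.inl ⟨rfl, hnear⟩)]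
          refine if_pos fun u hu => ?_
          rw [hθ]
          exact forall_normSign_two_mul_theta_eq_one hD hx hζ hσf hf V hV hσgα hσgβ hG0 hnear u hu
        · have hfar := far_of_not_near (d := d) hϖ hG0 hnear
          have hR : (if ((2 : Fin 3) = 2 ∧ Valued.v ϖ ^ ρ * Valued.v (gβ - gα) ≤ Valued.v ϖ ^ (2 * d - 1) * Valued.v (f * gα + gβ)) ∨ 2 * d - 1 ≤ ρ then (1 : ℤ) else 0) = 0 :=
            if_neg fun h => h.elim (fun h' => hnear h'.2) hal
          rw [hR, ite_eq_right_iff]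
          intro hall
          exfalso
          obtain ⟨u, hu, hne⟩ := exists_normSign_two_mul_theta_eq_neg_one hD h2 hρ hx hζ hσf hf V hV hσgα hσgβ hG0 hfar
          have h1 := hall u hu
          rw [hθ] at h1
          rw [h1] at hne
          norm_num at hne
  rw [hind, hωD]
  push_cast
  ring

end Summit.HodgeConjecture.HodgeConjecture.Cruxes.H413.F0P3cDyRamLabelledOddCoreHangingThetaRead

end
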